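import Summits.BirchSwinnertonDyer.BirchSwinnertonDyer.Theorems.EdixhovenFibreFiveSevenStarredOptimalManinUnitFiveSevenCellsOfSL2NeronValues
import Summits.BirchSwinnertonDyer.BirchSwinnertonDyer.Theorems.EdixhovenFibreFiveSevenStarredOptimalManinUnitFiveSevenSupersingularCellsModels
import HarnessLib

/-!
# Crux K★ `StarredOptimalManinUnitFiveSeven` (stmt-BirchSwinnertonDyer-22226), line `kato-lever`: the hDR binder on the three
# potentially SUPERSINGULAR cells `(5; IV*)`, `(5; II*)`, `(7; III*)` and K★ BY NAME, granted the ramified capstone `hR`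

Cell `pub/bsd-wall`, seat `bsd-line-edix-p1` g16 (unit (R1-MD)). Sequel of `…SupersingularCellsModels` (the explicit good
supersingular `𝒪_D`-models + descent, route-independent); this file plugs them into the route: the binder `hDRss` of
`…CellsOfSL2NeronValues.starredOptimalManinUnitFiveSeven_of_sl2NeronValues_of_isDeRham_supersingularCells` VERBATIM ⟸ `hR`, and the
route decl K★ BY NAME ⟸ {P1, hT₂, `hR`}. `hR` = the expected ramified good-supersingular capstone for `𝒪_D`-models (the
`𝒪_D`-analogue of `Literature.NumberTheory.PAdicHodge.isDeRham_restrictedRationalTateRep_of_goodSupersingular`; to be assembled from the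
(R1) ring `AinfRamified*` and the transcribed period files). TOOL theorems only; `--supports` 22226; CONDITIONAL (P1, hT₂ cite-only
XL; `hR` not yet a tree theorem); K★ stays OPEN ⟸ {P1, hT₂, hR}; BSD is not proved by any of this.

References: [DokchitserDokchitser2015LocalInvariants] Thm. 3.2; [SilvermanAEC2009] VII.5.5; [Fontaine1982FormesDifferentielles] §5;
[Kato2004Asterisque] (8.1.3), Thm. 9.7; [EdixhovenManin1991] Thm. 3.
-/

set_option autoImplicit false
-- the Theorems namespace of a single-conjunct summit repeats the summit name by design (D-0017)
set_option linter.dupNamespace false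

noncomputable section

open scoped Classical NumberField

open Polynomial WeierstrassCurve NumberField IsDedekindDomain Field ValuativeRel
  Literature.NumberTheory.EllipticCurves Literature.NumberTheory.EllipticCurves.ModularForms
  Literature.NumberTheory.EllipticCurves.Rank1Residual Literature.NumberTheory.EllipticCurves.Kato2004
  Literature.NumberTheory.DiophantineGeometry Rat.HeightOneSpectrum
  Literature.NumberTheory.PAdicHodge Literature.NumberTheory.GaloisRepresentations
  Literature.NumberTheory.GaloisRepresentations.IsNonarchimedeanLocalField
  Summit.BirchSwinnertonDyer.Rank1Residual.Additive
  Summit.BirchSwinnertonDyer.BirchSwinnertonDyer.Theorems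
  Summit.BirchSwinnertonDyer.BirchSwinnertonDyer.Theorems.StarredOptimalManinUnitFiveSevenCellsOfSL2NeronValues
  Summit.BirchSwinnertonDyer.BirchSwinnertonDyer.Theorems.StarredOptimalManinUnitFiveSevenSupersingularCellsModels

namespace Summit.BirchSwinnertonDyer.BirchSwinnertonDyer.Theorems.StarredOptimalManinUnitFiveSevenSupersingularCellsDeRham

section Capstone

-- `hR`: the expected ramified good-supersingular capstone for `𝒪_D`-models (analogue of `isDeRham_restrictedRationalTateRep_of_goodSupersingular`)
variable
  (hR : ∀ {F : Type} [Field F] [ValuativeRel F] [TopologicalSpace F] [IsNonarchimedeanLocalField F] [CharZero F]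
    {p : ℕ} [Fact p.Prime] [Fact (¬ IsUnit (p : integerC F))] [IsAdicComplete (Ideal.span {(p : integerC F)}) (integerC F)]
    (hp : valuation F p < 1) [Algebra ℚ_[p] F] (D : EisensteinRoot F p hp)
    {K₀ : Type} [Field K₀] [CharZero K₀] [Algebra K₀ F] (W₀ : WeierstrassCurve K₀) [W₀.IsElliptic]
    (WD : WeierstrassCurve D.Coeff),
    W₀.baseChange F = WD.map (EisensteinRoot.Coeff.toF D) → 5 ≤ p → IsUnit WD.Δ →
    (∀ γ : D.Coeff →+* 𝓀[F], (WD.map γ).hasseCoeff p = 0 ∧ PowerSeries.coeff (p ^ 2) ((WD.map γ).formalMul p) ≠ 0) →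
    GaloisRep.IsDeRham (bdRPeriodRingData (F := F) (p := p) hp) (restrictedRationalTateRep W₀ F p))

include hR

/-- **The hDR binder of `…CellsOfSL2NeronValues` on the three potentially supersingular starred cells, VERBATIM, granted `hR`.**
`(5; IV*)`: `K' = ℚ(5^{1/3})`, `(e,k,m,n,r₄,r₆,t₄,t₆) = (3,2,3,4,1,0,1,0)`; `(5; II*)`: `ℚ(5^{1/6})`, `(6,5,4,5,4,0,2,0)`; `(7; III*)`:
`ℚ(7^{1/4})`, `(4,3,3,5,0,2,0,1)`; `ord_p j ≥ 0`, `ord_p Δ_min ∈ {8, 9, 10}` by `padicValRat_j_nonneg_and_mem_of_starred`.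
[cite: DokchitserDokchitser2015LocalInvariants, Thm. 3.2] [cite: SilvermanAEC2009, VII.5.5] [cite: Fontaine1982FormesDifferentielles, §5] -/
theorem isDeRham_supersingularCells_of_ramifiedCapstone :
    ∀ (W : WeierstrassCurve ℚ) [W.IsElliptic] [W.IsGloballyMinimal] (p : ℕ) [Fact p.Prime],
      (p = 5 ∨ p = 7) → Addv W p → Irr W p →
      (∀ (v : HeightOneSpectrum ℤ) (n : ℕ), natGenerator v = p → W.kodairaSymbolAt v ≠ KodairaSymbol.Istar n) →
      4 < padicValInt p W.minimalDiscriminantInt → ¬ (p = 5 ↔ padicValInt p W.minimalDiscriminantInt = 9) →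
      ∀ (v : HeightOneSpectrum (𝓞 ℚ)), ((p : ℕ) : 𝓞 ℚ) ∈ v.asIdeal →
      ∀ [CharZero (v.adicCompletion ℚ)] [Fact (¬ IsUnit (p : integerC (v.adicCompletion ℚ)))]
        [IsAdicComplete (Ideal.span {(p : integerC (v.adicCompletion ℚ))}) (integerC (v.adicCompletion ℚ))]
        (hp' : valuation (v.adicCompletion ℚ) p < 1) [Algebra ℚ_[p] (v.adicCompletion ℚ)],
        GaloisRep.IsDeRham (bdRPeriodRingData (F := v.adicCompletion ℚ) (p := p) hp')
          (restrictedRationalTateRep W (v.adicCompletion ℚ) p) := by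
  intro W _ _ p _ hp57 hadd _ hIstar h4 hcell v hpv _ _ _ hp' _
  have hpr : p.Prime := Fact.out
  have hp5 : 5 ≤ p := by rcases hp57 with rfl | rfl <;> norm_num
  have hgen : Rat.HeightOneSpectrum.natGenerator (placeOf p) = p :=
    congrArg Subtype.val ((Rat.HeightOneSpectrum.primesEquiv (R := ℤ)).apply_symm_apply ⟨p, Fact.out⟩)
  have hI : ∀ n : ℕ, W.kodairaSymbolAt (placeOf p) ≠ .Istar n := fun n ↦ hIstar (placeOf p) n hgen
  obtain ⟨hj, hvΔ⟩ := padicValRat_j_nonneg_and_mem_of_starred W p hp5 hadd hI h4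
  rcases hp57 with rfl | rfl
  · have h9 : padicValInt 5 W.minimalDiscriminantInt ≠ 9 := fun h ↦ hcell ⟨fun _ ↦ h, fun _ ↦ rfl⟩
    rcases hvΔ with h8 | h9' | h10
    · obtain ⟨K', _, _, α, v', hαe, hv'⟩ := exists_numberField_pow_eq_prime (e := 3) (by norm_num) hpr
      exact isDeRham_adicCompletion_rat_of_model_of_ramifiedCapstone W 5 hR (Or.inl rfl) hj (e := 3) (k := 2) (m := 3)
        (n := 4) (r₄ := 1) (r₆ := 0) (t₄ := 1) (t₆ := 0) (by norm_num) (by norm_num) (by norm_num) (by norm_num)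
        (by norm_num) (by rw [h8]) (by rw [h8]) (by norm_num) (by norm_num) (fun _ ↦ one_pos) (fun h ↦ by norm_num at h)
        hαe v' hv' v hpv hp'
    · exact absurd h9' h9
    · obtain ⟨K', _, _, α, v', hαe, hv'⟩ := exists_numberField_pow_eq_prime (e := 6) (by norm_num) hpr
      exact isDeRham_adicCompletion_rat_of_model_of_ramifiedCapstone W 5 hR (Or.inl rfl) hj (e := 6) (k := 5) (m := 4)
        (n := 5) (r₄ := 4) (r₆ := 0) (t₄ := 2) (t₆ := 0) (by norm_num) (by norm_num) (by norm_num) (by norm_num)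
        (by norm_num) (by rw [h10]) (by rw [h10]) (by norm_num) (by norm_num) (fun _ ↦ by norm_num)
        (fun h ↦ by norm_num at h) hαe v' hv' v hpv hp'
  · have h9 : padicValInt 7 W.minimalDiscriminantInt = 9 := by
      by_contra h; exact hcell ⟨fun h7 ↦ by norm_num at h7, fun h9 ↦ absurd h9 h⟩
    obtain ⟨K', _, _, α, v', hαe, hv'⟩ := exists_numberField_pow_eq_prime (e := 4) (by norm_num) hpr
    exact isDeRham_adicCompletion_rat_of_model_of_ramifiedCapstone W 7 hR (Or.inr rfl) hj (e := 4) (k := 3) (m := 3)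
      (n := 5) (r₄ := 0) (r₆ := 2) (t₄ := 0) (t₆ := 1) (by norm_num) (by norm_num) (by norm_num) (by norm_num)
      (by norm_num) (by rw [h9]) (by rw [h9]) (by norm_num) (by norm_num) (fun h ↦ by norm_num at h) (fun _ ↦ by norm_num)
      hαe v' hv' v hpv hp'

/-- **K★ `StarredOptimalManinUnitFiveSeven` BY NAME, GRANTED {P1, hT₂, the ramified capstone `hR`}** — the de Rham input on the
(G)-ordinary cells is a tree theorem, on the supersingular cells it is `isDeRham_supersingularCells_of_ramifiedCapstone`.
CONDITIONAL; the item is not closed by this. [cite: Kato2004Asterisque, (8.1.3) (p. 180), Thm. 9.7 (p. 189)]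
[cite: Fontaine1982FormesDifferentielles, §5] [cite: EdixhovenManin1991, Thm. 3] -/
theorem starredOptimalManinUnitFiveSeven_of_sl2NeronValues_of_ramifiedCapstone
    (hT₂ : exists_smul_range_expStarCoord_tower_iff_trace_log) (hP1 : exists_member_sl2ZetaElement_neron_values) :
    Summit.BirchSwinnertonDyer.BirchSwinnertonDyer.Theses.EdixhovenFibreFiveSeven.StarredOptimalManinUnitFiveSeven :=
  starredOptimalManinUnitFiveSeven_of_sl2NeronValues_of_isDeRham_supersingularCells hT₂ hP1
    (fun W _ _ p _ hp57 hadd hirr hIstar h4 hcell v hpv _ _ _ hp' _ ↦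
      isDeRham_supersingularCells_of_ramifiedCapstone hR W p hp57 hadd hirr hIstar h4 hcell v hpv hp')

end Capstone

end Summit.BirchSwinnertonDyer.BirchSwinnertonDyer.Theorems.StarredOptimalManinUnitFiveSevenSupersingularCellsDeRham

end
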